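import Mathlib
import HarnessLib
import Summits.HubbardSuperconductivity.HubbardSuperconductivity.Theorems.KLProgrammeLatticeForwardBubble
import Summits.HubbardSuperconductivity.HubbardSuperconductivity.Theorems.KLProgrammeForwardBubbleRayTubeQuasi

/-!
# Route `KLProgramme` — ENGINE stmt-HubbardSuperconductivity-20437 `KLRegimeEngineV17F2`, row (c) value lane: the forward slice bubble on the MODEL CARRIER with angle-dependent
# QUASI-LIPSCHITZ radial data (brick L1 of cure (A″) route 3′ of located «(c)-OUT-COOPER-ANTIPODE»; cell gate-hubbard-kl, seat hubbard-kl-k3c2-p2 g25)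

WHY.  `klfl_lattice_forward_bubble_norm_le` (…LatticeForwardBubble, g4) uses the weight's GLOBAL Lipschitz constant `L_a` twice: for the lattice→continuum Riemann error
(`32Λₙ·K/L`, harmless) and as the UNIFORM radial modulus of the zero-sound remainder (vacuous at depth near the Cooper antipode — COOPER-ANTIPODE.md).  On route 3′ the
second use is replaced by per-ray TUBE-LOCAL QUASI-Lipschitz data `A₁(θ)|t−t′| + δ_A(θ)` (integrable angle profiles; what `klpe_ext_quasi_lipschitz_of_cell` supplies from CELL
lattice data), fed to `klfb_planar_bubble_norm_le_fn_tube_quasi`: the planar bracket becomes the θ-INTEGRAL of the per-ray bracket, with the scale-free defect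
`(131072/π)(ℓ+8M_F)(π√2/d)·δ_A(θ)` — booked downstream in the `¼Q.CL β n/L` slot since `δ_A ∝ (K + L_c)/L`.
* **`klfl_lattice_forward_bubble_norm_le_cells`**.
The g4 proof verbatim with the radial step and the planar call replaced; nothing about the model is asserted.  0 kit · 0 lit.
-/

noncomputable section

namespace Summit.HubbardSuperconductivity.HubbardSuperconductivity.Theorems.KLRegimeSplit

set_option linter.dupNamespace false -- summit = problem name (single-conjunct summit), D-0017

open Real Set Filter MeasureTheory Complex Literature.MathematicalPhysics.QuantumLattice Literature.Probability.LatticeModels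
open Literature.MathematicalPhysics.QuantumLattice.BandSectorCounting
open Summit.HubbardSuperconductivity.HubbardSuperconductivity.Theorems.PerturbedFermiCurve
open Summit.HubbardSuperconductivity.HubbardSuperconductivity.Theorems.KLProgrammeLegKernels
open scoped NNReal

section Lattice

variable {a' b' : ℝ} (B : BandBounds a' b') {δ : (Fin 2 → ℝ) → ℝ} (hδ1 : ContDiff ℝ 1 δ) {κ₀ κ₁ : ℝ}
  (hδ : ∀ k : Fin 2 → ℝ, (∀ i, |k i| ≤ π) → |δ k| ≤ κ₀)
  (hκ : ∀ k : Fin 2 → ℝ, (∀ i, |k i| ≤ π) → ‖fderiv ℝ δ k‖ ≤ κ₁) (hκ₁ : κ₁ < B.Dtmin)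

include B hδ1 hδ hκ hκ₁ in
/-- **THE FORWARD SLICE BUBBLE ON `MatsubaraIdx M × TorusSite 2 L` WITH ANGLE-DEPENDENT QUASI-LIPSCHITZ RADIAL DATA**: `klfl_lattice_forward_bubble_norm_le` VERBATIM except
that the weight's radial datum is asked PER RAY on the tube segment as `‖a(t·dir θ) − a(t'·dir θ)‖ ≤ A₁(θ)|t − t'| + δ_A(θ)` and the planar bracket is the θ-integral of the
per-ray bracket at `(A₀, A₁(θ) + 2A₀/zm, δ_A(θ))`; `L_a` serves only the Riemann error `32Λₙ·K/L`. -/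
theorem klfl_lattice_forward_bubble_norm_le_cells
    {κ₂ : ℝ} (hκ₂ : 0 ≤ κ₂)
    (hD2 : ∀ θ s t : ℝ, s ∈ Icc 0 (π / ‖dir θ‖) → t ∈ Icc 0 (π / ‖dir θ‖) →
      |fderiv ℝ δ (s • dir θ) (dir θ) - fderiv ℝ δ (t • dir θ) (dir θ)| ≤ κ₂ * |s - t|)
    {a : ℝ × ℝ → ℂ} (ha : Continuous a) (ha1 : ∀ x y, a (x + 2 * π, y) = a (x, y)) (ha2 : ∀ x y, a (x, y + 2 * π) = a (x, y))
    {A₀ La : ℝ} (hA0 : ∀ p, ‖a p‖ ≤ A₀) (hLa : ∀ p q, ‖a p - a q‖ ≤ La * dist p q)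
    {eb : ℝ × ℝ → ℝ} (hebc : Continuous eb) (heb1 : ∀ x y, eb (x + 2 * π, y) = eb (x, y)) (heb2 : ∀ x y, eb (x, y + 2 * π) = eb (x, y))
    {Le : ℝ} (hLe : ∀ p q, |eb p - eb q| ≤ Le * dist p q) {μ : ℝ} (heb : ∀ p ∈ Icc (-π) π ×ˢ Icc (-π) π, eb p = klfb_band δ μ p)
    {eb' : ℝ × ℝ → ℝ} (heb'c : Continuous eb') (heb'1 : ∀ x y, eb' (x + 2 * π, y) = eb' (x, y)) (heb'2 : ∀ x y, eb' (x, y + 2 * π) = eb' (x, y))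
    {Le' : ℝ} (hLe' : ∀ p q, |eb' p - eb' q| ≤ Le' * dist p q) {δmax : ℝ} (hδ0 : 0 ≤ δmax)
    (he'δ : ∀ p : ℝ × ℝ, |p.1| < π → |p.2| < π → |eb' p - klfb_band δ μ p| ≤ δmax)
    {zm : ℝ} (hzm : 0 < zm) {n : ℕ}
    (hzone : ∀ p ∈ Icc (-π) π ×ˢ Icc (-π) π, |eb p| < 4 * klScale klE0 n → |p.1| ≤ π - 2 * zm ∧ |p.2| ≤ π - 2 * zm)
    {A₁ δA : ℝ → ℝ} (hA1' : ∀ θ, 0 ≤ A₁ θ) (hδA' : ∀ θ, 0 ≤ δA θ)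
    (hA1i : IntegrableOn A₁ (Ioo (-π) π)) (hδAi : IntegrableOn δA (Ioo (-π) π))
    (haq : ∀ θ t t' : ℝ, 0 ≤ t → 0 ≤ t' → |klfb_band δ μ (t * Real.cos θ, t * Real.sin θ)| < 4 * klScale klE0 n →
      |klfb_band δ μ (t' * Real.cos θ, t' * Real.sin θ)| < 4 * klScale klE0 n →
      ‖a (t * Real.cos θ, t * Real.sin θ) - a (t' * Real.cos θ, t' * Real.sin θ)‖ ≤ A₁ θ * |t - t'| + δA θ)
    {f f' : ℝ → ℂ} {Lf Mf ℓf Lf' Mf' ℓ' LF MF ℓ : ℝ}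
    (hlip : ∀ s s', ‖f s - f s'‖ ≤ Lf * |s - s'|) (hbd : ∀ s, ‖f s‖ ≤ Mf) (hLf : Lf ≤ ℓf / klScale klE0 n ^ 2)
    (hin : ∀ s, s ≤ (klScale klE0 n / 2) ^ 2 → f s = 0) (hout : ∀ s, (4 * klScale klE0 n) ^ 2 ≤ s → f s = 0)
    (hlip' : ∀ s s', ‖f' s - f' s'‖ ≤ Lf' * |s - s'|) (hbd' : ∀ s, ‖f' s‖ ≤ Mf') (hLf' : Lf' ≤ ℓ' / klScale klE0 n ^ 2)
    (hin' : ∀ s, s ≤ (klScale klE0 n / 2) ^ 2 → f' s = 0) (hout' : ∀ s, (4 * klScale klE0 n) ^ 2 ≤ s → f' s = 0)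
    (hMF : 0 ≤ MF) (hFlip : ∀ s s', ‖f s * f' s - f s' * f' s'‖ ≤ LF * |s - s'|) (hFbd : ∀ s, ‖f s * f' s‖ ≤ MF)
    (hLF : LF ≤ ℓ / klScale klE0 n ^ 2)
    (hlo : a' < μ - 4 * klScale klE0 n - κ₀) (hhi : μ + 4 * klScale klE0 n + κ₀ < b')
    (q₀ : ℝ) {β : ℝ} (hβ : klBetaMin ≤ β) (hn : n ≤ nScales β + 1) {M : ℕ}
    (hM : β * (4 * klScale klE0 n) / (2 * Real.pi) + 1 ≤ M) (L : ℕ) [NeZero L] :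
    ‖β⁻¹ • ∑ i : MatsubaraIdx M, ((L ^ 2 : ℕ) : ℝ)⁻¹ • ∑ k : TorusSite 2 L,
        a (latticeMomentum L k 0, latticeMomentum L k 1) *
          klfb_prop f (matsubaraFreq β M i) (eb (latticeMomentum L k 0, latticeMomentum L k 1)) *
            klfb_prop f' (matsubaraFreq β M i + q₀) (eb' (latticeMomentum L k 0, latticeMomentum L k 1))‖ ≤
      ((2 * π) ^ 2)⁻¹ *
          (∫ θ in Ioo (-π) π,
            (524288 / Real.pi * (ℓ + 8 * MF) *
                (Real.pi * Real.sqrt 2 / (B.Dtmin - κ₁) * (A₁ θ + A₀ * (2 / zm)) / (B.Dtmin - κ₁) +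
                  A₀ * (1 / (B.Dtmin - κ₁) ^ 2 + Real.pi * Real.sqrt 2 * (2 + κ₂) / (B.Dtmin - κ₁) ^ 3)) * klScale klE0 n +
              131072 / Real.pi * (ℓ + 8 * MF) * (Real.pi * Real.sqrt 2 / (B.Dtmin - κ₁) * δA θ) +
              393216 / Real.pi * (ℓ + 8 * MF) * (A₀ * (Real.pi * Real.sqrt 2 / (B.Dtmin - κ₁))) * ((Real.pi / β) / klScale klE0 n) +
              1024 / Real.pi * Mf * (48 * ℓ' + 193 * Mf') * (A₀ * (Real.pi * Real.sqrt 2 / (B.Dtmin - κ₁))) * (|q₀| + δmax) /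
                klScale klE0 n)) +
        32 * klScale klE0 n *
            (La * (2 * Mf / klScale klE0 n) * (2 * Mf' / klScale klE0 n) +
              A₀ * ((9 * ℓf + 4 * Mf) / klScale klE0 n ^ 2 * Le) * (2 * Mf' / klScale klE0 n) +
              A₀ * (2 * Mf / klScale klE0 n) * ((9 * ℓ' + 4 * Mf') / klScale klE0 n ^ 2 * Le')) / L := by
  have hΛ := klth_klScale_pos n
  have hr₁ : 0 < klScale klE0 n / 2 := by positivity
  have hr : 0 < 4 * klScale klE0 n := by positivity
  have hA0' : 0 ≤ A₀ := (norm_nonneg _).trans (hA0 0)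
  have hLa0 : 0 ≤ La := by
    have h := hLa (1, 0) (0, 0)
    have hd : (0 : ℝ) < dist ((1 : ℝ), (0 : ℝ)) ((0 : ℝ), (0 : ℝ)) := by rw [Prod.dist_eq]; simp
    exact nonneg_of_mul_nonneg_left ((norm_nonneg _).trans h) hd
  have hLe0 : 0 ≤ Le := by
    have h := hLe (1, 0) (0, 0)
    have hd : (0 : ℝ) < dist ((1 : ℝ), (0 : ℝ)) ((0 : ℝ), (0 : ℝ)) := by rw [Prod.dist_eq]; simp
    exact nonneg_of_mul_nonneg_left ((abs_nonneg _).trans h) hd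
  have hLe'0 : 0 ≤ Le' := by
    have h := hLe' (1, 0) (0, 0)
    have hd : (0 : ℝ) < dist ((1 : ℝ), (0 : ℝ)) ((0 : ℝ), (0 : ℝ)) := by rw [Prod.dist_eq]; simp
    exact nonneg_of_mul_nonneg_left ((abs_nonneg _).trans h) hd
  have hMf : 0 ≤ Mf := (norm_nonneg _).trans (hbd 0)
  have hMf' : 0 ≤ Mf' := (norm_nonneg _).trans (hbd' 0)
  have hℓf : 0 ≤ 9 * ℓf + 4 * Mf := by
    have hLf0 : 0 ≤ Lf := by have := hlip 0 1; norm_num at this; linarith [norm_nonneg (f 0 - f 1)]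
    have : 0 ≤ ℓf := by
      have h := hLf0.trans hLf; rwa [le_div_iff₀ (by positivity), zero_mul] at h
    positivity
  have hℓ' : 0 ≤ 9 * ℓ' + 4 * Mf' := by
    have hLf0 : 0 ≤ Lf' := by have := hlip' 0 1; norm_num at this; linarith [norm_nonneg (f' 0 - f' 1)]
    have : 0 ≤ ℓ' := by
      have h := hLf0.trans hLf'; rwa [le_div_iff₀ (by positivity), zero_mul] at h
    positivity
  -- the planar weight `A = a·ψ`
  set A : ℝ × ℝ → ℂ := fun p => a p * (klfl_squareCut zm p : ℂ) with hAdef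
  have hψbd : ∀ p, ‖(klfl_squareCut zm p : ℂ)‖ ≤ 1 := fun p => by
    rw [Complex.norm_real, Real.norm_of_nonneg (klfl_squareCut_mem zm p).1]; exact (klfl_squareCut_mem zm p).2
  have hAc : Continuous A := ha.mul (Complex.continuous_ofReal.comp (klfl_continuous_squareCut zm))
  have hAsupp : ∀ p : ℝ × ℝ, A p ≠ 0 → |p.1| < π ∧ |p.2| < π := by
    intro p hp
    have hψ : klfl_squareCut zm p ≠ 0 := fun h0 => hp (by simp only [hAdef, h0, Complex.ofReal_zero, mul_zero])
    obtain ⟨h1, h2⟩ := klfl_abs_lt_of_squareCut_ne_zero hzm hψ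
    exact ⟨by linarith, by linarith⟩
  have hAbd : ∀ p, ‖A p‖ ≤ A₀ := fun p => by
    simp only [hAdef]; rw [norm_mul]
    calc ‖a p‖ * ‖(klfl_squareCut zm p : ℂ)‖ ≤ A₀ * 1 := mul_le_mul (hA0 p) (hψbd p) (norm_nonneg _) hA0'
      _ = A₀ := mul_one _
  have hArad : ∀ θ t t' : ℝ, 0 ≤ t → 0 ≤ t' → |klfb_band δ μ (t * Real.cos θ, t * Real.sin θ)| < 4 * klScale klE0 n →
      |klfb_band δ μ (t' * Real.cos θ, t' * Real.sin θ)| < 4 * klScale klE0 n →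
      ‖A (t * Real.cos θ, t * Real.sin θ) - A (t' * Real.cos θ, t' * Real.sin θ)‖ ≤ (A₁ θ + A₀ * (2 / zm)) * |t - t'| + δA θ := by
    intro θ t t' ht ht' hb hb'
    set x := (t * Real.cos θ, t * Real.sin θ) with hx
    set y := (t' * Real.cos θ, t' * Real.sin θ) with hy
    have hd : dist x y ≤ |t - t'| := klfl_dist_ray_le θ t t'
    have hA1θ := hA1' θ
    have hδAθ := hδA' θ
    have hsplit : A x - A y = (a x - a y) * (klfl_squareCut zm x : ℂ) + a y * ((klfl_squareCut zm x : ℂ) - (klfl_squareCut zm y : ℂ)) := by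
      simp only [hAdef]; ring
    rw [hsplit]
    have h1 : ‖(a x - a y) * (klfl_squareCut zm x : ℂ)‖ ≤ (A₁ θ * |t - t'| + δA θ) * 1 := by
      rw [norm_mul]
      exact mul_le_mul (haq θ t t' ht ht' hb hb') (hψbd x) (norm_nonneg _) (by positivity)
    have h2 : ‖a y * ((klfl_squareCut zm x : ℂ) - (klfl_squareCut zm y : ℂ))‖ ≤ A₀ * (2 / zm * |t - t'|) := by
      rw [norm_mul, ← Complex.ofReal_sub, Complex.norm_real, Real.norm_eq_abs]
      exact mul_le_mul (hA0 y) ((klfl_squareCut_lipschitz hzm x y).trans (mul_le_mul_of_nonneg_left hd (by positivity)))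
        (abs_nonneg _) hA0'
    calc _ ≤ ‖(a x - a y) * (klfl_squareCut zm x : ℂ)‖ + ‖a y * ((klfl_squareCut zm x : ℂ) - (klfl_squareCut zm y : ℂ))‖ := norm_add_le _ _
      _ ≤ (A₁ θ * |t - t'| + δA θ) * 1 + A₀ * (2 / zm * |t - t'|) := add_le_add h1 h2
      _ = (A₁ θ + A₀ * (2 / zm)) * |t - t'| + δA θ := by ring
  -- the planar bound
  have hA1s' : ∀ θ, 0 ≤ A₁ θ + A₀ * (2 / zm) := fun θ => by have := hA1' θ; positivity
  have hA1si : IntegrableOn (fun θ => A₁ θ + A₀ * (2 / zm)) (Ioo (-π) π) := by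
    have hvol : volume (Ioo (-π) π) < ⊤ := by rw [Real.volume_Ioo]; exact ENNReal.ofReal_lt_top
    exact hA1i.add (integrableOn_const (hs := hvol.ne))
  have hB := klfb_planar_bubble_norm_le_fn_tube_quasi B hδ1 hδ hκ hκ₁ hAc hAsupp (A₀ := fun _ => A₀) (fun _ => hA0') hA1s' hδA'
    (by have hvol : volume (Ioo (-π) π) < ⊤ := by rw [Real.volume_Ioo]; exact ENNReal.ofReal_lt_top
        exact integrableOn_const (hs := hvol.ne)) hA1si hδAi
    (fun θ t _ _ => hAbd _) hArad hκ₂ hD2 hlip hbd hin hout hlip' hbd' hLf' hin' hout'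
    hMF hFlip hFbd hLF heb'c hδ0 he'δ hlo hhi q₀ hβ hn hM
  -- the periodic family and its properties
  set F : MatsubaraIdx M → ℝ × ℝ → ℂ := fun i p =>
    a p * klfb_prop f (matsubaraFreq β M i) (eb p) * klfb_prop f' (matsubaraFreq β M i + q₀) (eb' p) with hFdef
  have hΦc : ∀ k₀, Continuous fun e => klfb_prop f k₀ e := fun k₀ => klfb_continuous_prop_snd hlip hbd hin hout hr₁ hr k₀
  have hΨc : ∀ k₀, Continuous fun e => klfb_prop f' k₀ e := fun k₀ => klfb_continuous_prop_snd hlip' hbd' hin' hout' hr₁ hr k₀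
  have hFc : ∀ i, Continuous (F i) := fun i => (ha.mul ((hΦc _).comp hebc)).mul ((hΨc _).comp heb'c)
  have hF1 : ∀ i x y, F i (x + 2 * π, y) = F i (x, y) := fun i x y => by simp only [hFdef, ha1, heb1, heb'1]
  have hF2 : ∀ i x y, F i (x, y + 2 * π) = F i (x, y) := fun i x y => by simp only [hFdef, ha2, heb2, heb'2]
  set K : ℝ := La * (2 * Mf / klScale klE0 n) * (2 * Mf' / klScale klE0 n) +
    A₀ * ((9 * ℓf + 4 * Mf) / klScale klE0 n ^ 2 * Le) * (2 * Mf' / klScale klE0 n) +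
    A₀ * (2 * Mf / klScale klE0 n) * ((9 * ℓ' + 4 * Mf') / klScale klE0 n ^ 2 * Le') with hKdef
  have hK0 : 0 ≤ K := by rw [hKdef]; positivity
  have hFlip' : ∀ i (p q : ℝ × ℝ), ‖F i p - F i q‖ ≤ (K.toNNReal : ℝ) * dist p q := by
    intro i p q
    rw [Real.coe_toNNReal _ hK0]
    have hv : ∀ p q : ℝ × ℝ, ‖klfb_prop f (matsubaraFreq β M i) (eb p) - klfb_prop f (matsubaraFreq β M i) (eb q)‖ ≤
        (9 * ℓf + 4 * Mf) / klScale klE0 n ^ 2 * Le * dist p q :=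
      fun p q => (klfl_prop_lipschitz_snd hlip hbd hLf hin hout (matsubaraFreq β M i) (eb p) (eb q)).trans (by
        rw [mul_assoc]; exact mul_le_mul_of_nonneg_left (hLe p q) (by positivity))
    have hw : ∀ p q : ℝ × ℝ, ‖klfb_prop f' (matsubaraFreq β M i + q₀) (eb' p) - klfb_prop f' (matsubaraFreq β M i + q₀) (eb' q)‖ ≤
        (9 * ℓ' + 4 * Mf') / klScale klE0 n ^ 2 * Le' * dist p q :=
      fun p q => (klfl_prop_lipschitz_snd hlip' hbd' hLf' hin' hout' (matsubaraFreq β M i + q₀) (eb' p) (eb' q)).trans (by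
        rw [mul_assoc]; exact mul_le_mul_of_nonneg_left (hLe' p q) (by positivity))
    exact klfl_lipschitz_triple (u := a) (v := fun p => klfb_prop f (matsubaraFreq β M i) (eb p))
      (w := fun p => klfb_prop f' (matsubaraFreq β M i + q₀) (eb' p))
      hA0 (fun p => klfl_prop_norm_le hbd hin (matsubaraFreq β M i) (eb p))
      (fun p => klfl_prop_norm_le hbd' hin' (matsubaraFreq β M i + q₀) (eb' p)) hLa hv hw p q
  have hFh : ∀ i, ∀ p ∈ Icc (-π) π ×ˢ Icc (-π) π, F i p = klfb_integrand δ μ A f f' eb' (matsubaraFreq β M i) q₀ p :=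
    fun i p hp => klfl_integrand_eq_on_square hzm heb hzone hout (matsubaraFreq β M i) q₀ hp
  have hh0 : ∀ i, ∀ p ∉ Icc (-π) π ×ˢ Icc (-π) π, klfb_integrand δ μ A f f' eb' (matsubaraFreq β M i) q₀ p = 0 :=
    fun i p hp => klfl_integrand_eq_zero_off_square hzm (matsubaraFreq β M i) q₀ hp
  have hzero : ∀ i, 4 * klScale klE0 n ≤ |matsubaraFreq β M i| → ∀ p, F i p = 0 := by
    intro i hi p
    simp only [hFdef]
    rw [klfl_prop_eq_zero_of_le_abs_fst hout hi, mul_zero, zero_mul]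
  have h := klfl_matsubara_latticeAverage_norm_le_scale (F := F) (h := fun i => klfb_integrand δ μ A f f' eb' (matsubaraFreq β M i) q₀)
    hβ hn hFc hF1 hF2 hFlip' hFh hh0 hzero hB L
  rw [Real.coe_toNNReal _ hK0] at h
  exact h

end Lattice

end Summit.HubbardSuperconductivity.HubbardSuperconductivity.Theorems.KLRegimeSplit

end
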